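import Literature.Analysis.FluidPDE.ElgindiAngularDataBound
import Literature.Analysis.FluidPDE.ElgindiAngularOperatorExpansion
import Literature.Analysis.FluidPDE.ElgindiPolarSingularWeights
import HarnessLib

/-!
# Identifications for the `𝓗⁴` elliptic assembly: weight monotonicity, commutations, and `D_θ^i` versus `∂_θ^i`
([Elgindi2021] §7.3–7.4; [ElgindiGhoulMasmoudi2021] §1.7, §6)

Topic `Literature/Analysis/FluidPDE`. Proof file (everything proved, no definitions, no named
facts) on the proof path of the named fact
`Literature.Analysis.FluidPDE.Elgindi.ElgindiGhoulMasmoudi2021_stabilityCore`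
(`ElgindiStabilityDecomposition.lean`). [Elgindi2021] §7.3, proof of Proposition 7.7 (p. 22 of
arXiv:1904.04795), Step 4: "Upon integrating and using steps 1 and 2, we can show:
`∫∫ sin(2θ)^{2−γ}|∂_θ∂_θθΨ|²w² ≤ C|F|²_{𝓗¹}`. We omit the details except to say that terms with less
derivatives on Ψ̄ can be handled using (radialweightonlyL2) and the weighted Hardy inequalty in
Lemma 7.5", and Step 5: "note that all lower order terms have been controlled".

The bookkeeping behind "using steps 1 and 2" / "lower order terms have been controlled" in the tree's
vocabulary: every lower-order quantity met by the level-`k` estimate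
(`ElgindiAngularLevelEstimate.lean`, `ElgindiAngularDataBound.lean`) is dominated by a quantity of a
lower level or of Steps 1–3 (`ElgindiPolarStepThree.lean`), because the level weights
`sin(2θ)^{2k−γ}` decrease in `k` and are dominated by `1` and by `sin(2θ)^{−η}`:

* `integral_weight_rpow_mono`, `integral_weight_rpow_le_unweighted`,
  `integral_weight_rpow_le_singular`, `integral_weight_le_singular` (weight monotonicity);
* `iterate_dθ_iterate_Dz_comm` (`∂_θ^nD_R^m = D_R^m∂_θ^n` on the strip), `dθ_Dz_strip`
  (`∂_θD_Rf = R∂_R∂_θf`), `iterate_Dz_succ_succ` (`D_R^{m+2} = R²∂_RRD_R^m + D_R^{m+1}`);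
* `sq_iterate_Dθ_mul_rpow_le_four` (up) and `rpow_mul_sq_iterate_dθ_le_four` (down): on the strip,
  `(D_θ^ig)²s^{−γ} ≤ K Σ_{n≤i}(∂_θ^ng)²s^{2n−γ}` and `(∂_θ^ig)²s^{2i−γ} ≤ K' Σ_{n≤i}(D_θ^ng)²s^{−γ}`,
  `i ≤ 4`, from the expansions of `ElgindiAngularOperatorExpansion.lean`.
-/

noncomputable section

open MeasureTheory Set Real Filter Function Finset
open _root_.Topology

namespace Literature.Analysis.FluidPDE

namespace Elgindi

/-! ### Weight monotonicity -/

section weights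

variable {W : ℝ → ℝ} (hWc : ContinuousOn W (Ioi 0)) (hW0 : ∀ R, 0 < R → 0 ≤ W R)
  {g : ℝ × ℝ → ℝ} (hg : Continuous g) (hgs : HasCompactSupport g) (hgpos : ∀ p ∈ tsupport g, 0 < p.1)
include hWc hW0 hg hgs hgpos

/-- The level weights decrease: `∫∫ Wg²s^{r'} ≤ ∫∫ Wg²s^{r}` for `0 ≤ r ≤ r'`. [folklore] -/
theorem integral_weight_rpow_mono {r r' : ℝ} (hr : 0 ≤ r) (hrr' : r ≤ r') :
    (∫ p in strip, W p.1 * g p ^ 2 * Real.sin (2 * p.2) ^ r') ≤ ∫ p in strip, W p.1 * g p ^ 2 * Real.sin (2 * p.2) ^ r := by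
  have hs2 : HasCompactSupport fun p => g p ^ 2 := hasCompactSupport_of_eq_zero hgs fun p hp => by simp [hp]
  have hp2 : ∀ p ∈ tsupport (fun p => g p ^ 2), 0 < p.1 := fun p hp =>
    hgpos p (tsupport_subset_of_eq_zero (X := g) (fun q hq => by simp [hq]) hp)
  have i1 : Integrable fun p : ℝ × ℝ => W p.1 * g p ^ 2 * Real.sin (2 * p.2) ^ r' :=
    integrable_weight_mul_rpow hWc (by fun_prop) hs2 hp2 (hr.trans hrr')
  have i2 : Integrable fun p : ℝ × ℝ => W p.1 * g p ^ 2 * Real.sin (2 * p.2) ^ r :=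
    integrable_weight_mul_rpow hWc (by fun_prop) hs2 hp2 hr
  refine setIntegral_mono_on i1.integrableOn i2.integrableOn measurableSet_strip fun p hp => ?_
  exact mul_le_mul_of_nonneg_left (sin_two_mul_rpow_le_rpow hrr' hp.2) (mul_nonneg (hW0 p.1 hp.1) (sq_nonneg _))

/-- `∫∫ Wg²s^{r} ≤ ∫∫ Wg²` for `r ≥ 0`. [folklore] -/
theorem integral_weight_rpow_le_unweighted {r : ℝ} (hr : 0 ≤ r) :
    (∫ p in strip, W p.1 * g p ^ 2 * Real.sin (2 * p.2) ^ r) ≤ ∫ p in strip, W p.1 * g p ^ 2 := by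
  have h := integral_weight_rpow_mono hWc hW0 hg hgs hgpos (r := 0) le_rfl hr
  have e : (∫ p in strip, W p.1 * g p ^ 2 * Real.sin (2 * p.2) ^ (0 : ℝ)) = ∫ p in strip, W p.1 * g p ^ 2 :=
    integral_congr_ae (ae_of_all _ fun p => by simp only [Real.rpow_zero, mul_one])
  rwa [e] at h

/-- `∫∫ Wg²s^{r} ≤ ∫∫ Wg²s^{−η}` for `r ≥ 0` (`η = 99/100`). [folklore] -/
theorem integral_weight_rpow_le_singular {r : ℝ} (hr : 0 ≤ r) :
    (∫ p in strip, W p.1 * g p ^ 2 * Real.sin (2 * p.2) ^ r) ≤ ∫ p in strip, W p.1 * g p ^ 2 * Real.sin (2 * p.2) ^ (-eta) := by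
  have hs2 : HasCompactSupport fun p => g p ^ 2 := hasCompactSupport_of_eq_zero hgs fun p hp => by simp [hp]
  have hp2 : ∀ p ∈ tsupport (fun p => g p ^ 2), 0 < p.1 := fun p hp =>
    hgpos p (tsupport_subset_of_eq_zero (X := g) (fun q hq => by simp [hq]) hp)
  have i1 : Integrable fun p : ℝ × ℝ => W p.1 * g p ^ 2 * Real.sin (2 * p.2) ^ r :=
    integrable_weight_mul_rpow hWc (by fun_prop) hs2 hp2 hr
  obtain ⟨a, ha, hva⟩ := exists_pos_forall_fst_lt_eq_zero hs2 hp2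
  have hc : Continuous fun p : ℝ × ℝ => W p.1 * g p ^ 2 := continuous_weight_mul₂ hWc (by fun_prop) ha hva
  have hcs : HasCompactSupport fun p : ℝ × ℝ => W p.1 * g p ^ 2 := hasCompactSupport_of_eq_zero hs2 fun p hp => by
    show W p.1 * g p ^ 2 = 0
    rw [show g p ^ 2 = 0 from hp, mul_zero]
  have i2 : IntegrableOn (fun p : ℝ × ℝ => W p.1 * g p ^ 2 * Real.sin (2 * p.2) ^ (-eta)) strip :=
    integrableOn_strip_mul_rpow_of_continuous eta_pos.le (by norm_num [eta]) hc hcs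
  refine setIntegral_mono_on i1.integrableOn i2 measurableSet_strip fun p hp => ?_
  refine mul_le_mul_of_nonneg_left (sin_two_mul_rpow_le_rpow ?_ hp.2) (mul_nonneg (hW0 p.1 hp.1) (sq_nonneg _))
  linarith [eta_pos]

/-- `∫∫ Wg² ≤ ∫∫ Wg²s^{−η}`. [folklore] -/
theorem integral_weight_le_singular :
    (∫ p in strip, W p.1 * g p ^ 2) ≤ ∫ p in strip, W p.1 * g p ^ 2 * Real.sin (2 * p.2) ^ (-eta) := by
  have h := integral_weight_rpow_le_singular hWc hW0 hg hgs hgpos (r := 0) le_rfl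
  have e : (∫ p in strip, W p.1 * g p ^ 2 * Real.sin (2 * p.2) ^ (0 : ℝ)) = ∫ p in strip, W p.1 * g p ^ 2 :=
    integral_congr_ae (ae_of_all _ fun p => by simp only [Real.rpow_zero, mul_one])
  rwa [e] at h

end weights

/-! ### Commutations on the strip -/

/-- **`∂_θ^n D_R^m f = D_R^m ∂_θ^n f` on the open strip** for `f ∈ C^{n+m}`. [folklore] -/
theorem iterate_dθ_iterate_Dz_comm (n m : ℕ) : ∀ {f : ℝ → ℝ → ℝ}, ContDiff ℝ ((n + m : ℕ) : WithTop ℕ∞) (uncurry f) →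
    ∀ p ∈ strip, (dθ^[n] (Dz^[m] f)) p.1 p.2 = (Dz^[m] (dθ^[n] f)) p.1 p.2 := by
  induction m with
  | zero => intro f _ p _; rfl
  | succ m ih =>
    intro f hf p hp
    have hf1 : ContDiff ℝ ((n + 1 : ℕ) : WithTop ℕ∞) (uncurry f) := hf.of_le (by exact_mod_cast (show n + 1 ≤ n + (m + 1) by omega))
    have hDf : ContDiff ℝ ((n + m : ℕ) : WithTop ℕ∞) (uncurry (Dz f)) := by
      refine contDiff_Dz_of_contDiff ?_
      have e : ((n + (m + 1) : ℕ) : WithTop ℕ∞) = ((n + m : ℕ) : WithTop ℕ∞) + 1 := by push_cast; ring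
      rw [← e]; exact hf
    rw [Function.iterate_succ_apply, Function.iterate_succ_apply, ih hDf p hp]
    exact iterate_Dz_congr (fun q hq => iterate_dθ_Dz_comm hf1 hq) m p hp

/-- `∂_θ^n D_R^m ∂_θθ f = ∂_θ^{n+2} D_R^m f` on the open strip for `f ∈ C^{n+m+2}`. [folklore] -/
theorem iterate_dθ_iterate_Dz_dθ_dθ (n m : ℕ) {f : ℝ → ℝ → ℝ} (hf : ContDiff ℝ ((n + m + 2 : ℕ) : WithTop ℕ∞) (uncurry f))
    {p : ℝ × ℝ} (hp : p ∈ strip) : (dθ^[n] (Dz^[m] (dθ (dθ f)))) p.1 p.2 = (dθ^[n + 2] (Dz^[m] f)) p.1 p.2 := by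
  have e1 : ((n + m + 2 : ℕ) : WithTop ℕ∞) = ((n + m + 1 : ℕ) : WithTop ℕ∞) + 1 := by push_cast; ring
  have e0 : ((n + m + 1 : ℕ) : WithTop ℕ∞) = ((n + m : ℕ) : WithTop ℕ∞) + 1 := by push_cast; ring
  have hd1 : ContDiff ℝ ((n + m + 1 : ℕ) : WithTop ℕ∞) (uncurry (dθ f)) := contDiff_dθ_of_contDiff (by rw [← e1]; exact hf)
  have hd2 : ContDiff ℝ ((n + m : ℕ) : WithTop ℕ∞) (uncurry (dθ (dθ f))) := contDiff_dθ_of_contDiff (by rw [← e0]; exact hd1)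
  have hf' : ContDiff ℝ ((n + 2 + m : ℕ) : WithTop ℕ∞) (uncurry f) := by
    have e : n + 2 + m = n + m + 2 := by ring
    rw [e]; exact hf
  rw [iterate_dθ_iterate_Dz_comm n m hd2 p hp, show dθ^[n] (dθ (dθ f)) = dθ^[n + 2] f from (Function.iterate_add_apply dθ n 2 f).symm,
    ← iterate_dθ_iterate_Dz_comm (n + 2) m hf' p hp]

/-- `∂_θ(D_Rf) = R∂_R∂_θ f` on the strip for `f ∈ C²`. [folklore] -/
theorem dθ_Dz_strip {f : ℝ → ℝ → ℝ} (hf : ContDiff ℝ 2 (uncurry f)) {p : ℝ × ℝ} (hp : p ∈ strip) :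
    dθ (Dz f) p.1 p.2 = p.1 * dz (dθ f) p.1 p.2 := by
  rw [dθ_Dz, dθ_dz_eq_dz_dθ hf.contDiffOn hp]

/-- `D_R^{m+2}f = R²∂_RR(D_R^mf) + D_R^{m+1}f` for `D_R^mf ∈ C²`. [folklore] -/
theorem iterate_Dz_succ_succ (m : ℕ) {f : ℝ → ℝ → ℝ} (hf : ContDiff ℝ 2 (uncurry (Dz^[m] f))) (R θ : ℝ) :
    (Dz^[m + 2] f) R θ = R ^ 2 * dz (dz (Dz^[m] f)) R θ + (Dz^[m + 1] f) R θ := by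
  have e2 : (Dz^[m + 2] f) = Dz (Dz (Dz^[m] f)) := by
    rw [show m + 2 = m + 1 + 1 by ring, Function.iterate_succ_apply', Function.iterate_succ_apply']
  have e1 : (Dz^[m + 1] f) = Dz (Dz^[m] f) := Function.iterate_succ_apply' Dz m f
  rw [e2, e1, Dz_eq_mul_dz, dz_Dz hf, Dz_eq_mul_dz]
  ring

/-! ### `D_θ^i` versus `∂_θ^i` with the `𝓗ᵏ` weights, `i ≤ 4` -/

/-- rpow bookkeeping on the strip: `s^{2n}·s^{−γ} = s^{2n−γ}`. [folklore] -/
theorem sin_pow_mul_rpow_neg {p : ℝ × ℝ} (hp : p ∈ strip) (n : ℕ) (γ : ℝ) :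
    Real.sin (2 * p.2) ^ (2 * n) * Real.sin (2 * p.2) ^ (-γ) = Real.sin (2 * p.2) ^ ((2 * n : ℕ) - γ : ℝ) := by
  have hs : 0 < Real.sin (2 * p.2) := Real.sin_pos_of_pos_of_lt_pi (by linarith [hp.2.1]) (by linarith [hp.2.2])
  rw [← Real.rpow_natCast, ← Real.rpow_add hs, ← sub_eq_add_neg]

section conversion

variable {g : ℝ → ℝ → ℝ} (hg : ContDiff ℝ 4 (uncurry g)) {p : ℝ × ℝ} (hp : p ∈ strip)
include hg hp

/-- **(up) `(D_θ^ig)²s^{−γ} ≤ 6400 Σ_{n=1}^{4}(∂_θ^ng)²s^{2n−γ}` on the strip for `1 ≤ i ≤ 4`** (one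
uniform constant). [cite: ElgindiGhoulMasmoudi2021, §1.7 (p. 6 of arXiv:1910.14071): D_θ = sin(2θ)∂_θ in the 𝓗ᵏ norm] -/
theorem sq_iterate_Dθ_mul_rpow_le_four {i : ℕ} (hi1 : 1 ≤ i) (hi4 : i ≤ 4) (γ : ℝ) :
    (Dθ^[i] g) p.1 p.2 ^ 2 * Real.sin (2 * p.2) ^ (-γ) ≤
      6400 * ((dθ^[1] g) p.1 p.2 ^ 2 * Real.sin (2 * p.2) ^ ((2 : ℕ) - γ : ℝ) + (dθ^[2] g) p.1 p.2 ^ 2 * Real.sin (2 * p.2) ^ ((4 : ℕ) - γ : ℝ) +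
        (dθ^[3] g) p.1 p.2 ^ 2 * Real.sin (2 * p.2) ^ ((6 : ℕ) - γ : ℝ) + (dθ^[4] g) p.1 p.2 ^ 2 * Real.sin (2 * p.2) ^ ((8 : ℕ) - γ : ℝ)) := by
  have hu := contDiff_slice_θ hg p.1
  have hρ : 0 ≤ Real.sin (2 * p.2) ^ (-γ) :=
    Real.rpow_nonneg (Real.sin_pos_of_pos_of_lt_pi (by linarith [hp.2.1]) (by linarith [hp.2.2])).le _
  -- rewrite everything through the slice `u = g(p.1, ·)`
  rw [iterate_Dθ_apply, iterate_dθ_apply, iterate_dθ_apply, iterate_dθ_apply, iterate_dθ_apply]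
  have e1 := sin_pow_mul_rpow_neg hp 1 γ
  have e2 := sin_pow_mul_rpow_neg hp 2 γ
  have e3 := sin_pow_mul_rpow_neg hp 3 γ
  have e4 := sin_pow_mul_rpow_neg hp 4 γ
  simp only [show 2 * 1 = 2 from rfl, show 2 * 2 = 4 from rfl, show 2 * 3 = 6 from rfl, show 2 * 4 = 8 from rfl] at e1 e2 e3 e4
  rw [← e1, ← e2, ← e3, ← e4]
  set u : ℝ → ℝ := fun θ' => g p.1 θ'
  set S := Real.sin (2 * p.2)
  set ρ := Real.sin (2 * p.2) ^ (-γ)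
  have n1 : 0 ≤ iteratedDeriv 1 u p.2 ^ 2 * S ^ 2 * ρ := by positivity
  have n2 : 0 ≤ iteratedDeriv 2 u p.2 ^ 2 * S ^ 4 * ρ := by positivity
  have n3 : 0 ≤ iteratedDeriv 3 u p.2 ^ 2 * S ^ 6 * ρ := by positivity
  have n4 : 0 ≤ iteratedDeriv 4 u p.2 ^ 2 * S ^ 8 * ρ := by positivity
  interval_cases i
  · have h := sq_iterate_Dθ₁_one u p.2
    have : (Dθ₁^[1] u) p.2 ^ 2 * ρ = iteratedDeriv 1 u p.2 ^ 2 * S ^ 2 * ρ := by rw [h]; ring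
    nlinarith [this]
  · have h := mul_le_mul_of_nonneg_right (sq_iterate_Dθ₁_two_le hu p.2) hρ
    nlinarith [h]
  · have h := mul_le_mul_of_nonneg_right (sq_iterate_Dθ₁_three_le hu p.2) hρ
    nlinarith [h]
  · have h := mul_le_mul_of_nonneg_right (sq_iterate_Dθ₁_four_le hu p.2) hρ
    nlinarith [h]

/-- **(down) `(∂_θ^ig)²s^{2i−γ} ≤ 556800 Σ_{n=1}^{4}(D_θ^ng)²s^{−γ}` on the strip for `1 ≤ i ≤ 4`**.
[cite: ElgindiGhoulMasmoudi2021, §1.7 (p. 6 of arXiv:1910.14071): D_θ = sin(2θ)∂_θ in the 𝓗ᵏ norm] -/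
theorem rpow_mul_sq_iterate_dθ_le_four {i : ℕ} (hi1 : 1 ≤ i) (hi4 : i ≤ 4) (γ : ℝ) :
    (dθ^[i] g) p.1 p.2 ^ 2 * Real.sin (2 * p.2) ^ ((2 * i : ℕ) - γ : ℝ) ≤
      556800 * (((Dθ^[1] g) p.1 p.2 ^ 2 + (Dθ^[2] g) p.1 p.2 ^ 2 + (Dθ^[3] g) p.1 p.2 ^ 2 + (Dθ^[4] g) p.1 p.2 ^ 2) *
        Real.sin (2 * p.2) ^ (-γ)) := by
  have hu := contDiff_slice_θ hg p.1
  have hρ : 0 ≤ Real.sin (2 * p.2) ^ (-γ) :=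
    Real.rpow_nonneg (Real.sin_pos_of_pos_of_lt_pi (by linarith [hp.2.1]) (by linarith [hp.2.2])).le _
  rw [← sin_pow_mul_rpow_neg hp i γ, iterate_Dθ_apply, iterate_Dθ_apply, iterate_Dθ_apply, iterate_Dθ_apply, iterate_dθ_apply]
  set u : ℝ → ℝ := fun θ' => g p.1 θ'
  set S := Real.sin (2 * p.2)
  set ρ := Real.sin (2 * p.2) ^ (-γ)
  have q1 : (Dθ₁^[1] u) p.2 ^ 2 = S ^ 2 * iteratedDeriv 1 u p.2 ^ 2 := sq_iterate_Dθ₁_one u p.2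
  have q2 := sq_sin_pow_mul_iteratedDeriv_two_le hu p.2
  have q3 := sq_sin_pow_mul_iteratedDeriv_three_le hu p.2
  have q4 := sq_sin_pow_mul_iteratedDeriv_four_le hu p.2
  have d1 : 0 ≤ (Dθ₁^[1] u) p.2 ^ 2 * ρ := by positivity
  have d2 : 0 ≤ (Dθ₁^[2] u) p.2 ^ 2 * ρ := by positivity
  have d3 : 0 ≤ (Dθ₁^[3] u) p.2 ^ 2 * ρ := by positivity
  have d4 : 0 ≤ (Dθ₁^[4] u) p.2 ^ 2 * ρ := by positivity
  -- closed forms: S⁴u₂² ≤ 2D₂² + 8D₁²; S⁶u₃² ≤ 3D₃² + 216D₂² + 912D₁²; S⁸u₄² ≤ 4D₄² + 1728D₃² + 130688D₂² + 556800D₁²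
  have c2 : S ^ 4 * iteratedDeriv 2 u p.2 ^ 2 ≤ 2 * (Dθ₁^[2] u) p.2 ^ 2 + 8 * (Dθ₁^[1] u) p.2 ^ 2 := by rw [q1]; linarith
  have c3 : S ^ 6 * iteratedDeriv 3 u p.2 ^ 2 ≤ 3 * (Dθ₁^[3] u) p.2 ^ 2 + 216 * (Dθ₁^[2] u) p.2 ^ 2 + 912 * (Dθ₁^[1] u) p.2 ^ 2 := by
    rw [q1]; nlinarith [c2]
  have c4 : S ^ 8 * iteratedDeriv 4 u p.2 ^ 2 ≤ 4 * (Dθ₁^[4] u) p.2 ^ 2 + 1728 * (Dθ₁^[3] u) p.2 ^ 2 + 130688 * (Dθ₁^[2] u) p.2 ^ 2 +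
      556800 * (Dθ₁^[1] u) p.2 ^ 2 := by
    rw [q1]; nlinarith [c2, c3]
  interval_cases i
  · simp only [Nat.mul_one]
    have : iteratedDeriv 1 u p.2 ^ 2 * (S ^ 2 * ρ) = (Dθ₁^[1] u) p.2 ^ 2 * ρ := by rw [q1]; ring
    nlinarith [this]
  · have h := mul_le_mul_of_nonneg_right c2 hρ
    simp only [show 2 * 2 = 4 from rfl]
    nlinarith [h]
  · have h := mul_le_mul_of_nonneg_right c3 hρ
    simp only [show 2 * 3 = 6 from rfl]
    nlinarith [h]
  · have h := mul_le_mul_of_nonneg_right c4 hρ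
    simp only [show 2 * 4 = 8 from rfl]
    nlinarith [h]

end conversion

end Elgindi

end Literature.Analysis.FluidPDE
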